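import Summits.KontsevichZagierPeriods.KontsevichZagierPeriods.Theorems.HurwitzMicroSectorsNormalFormPrincipleLevelOne
import Summits.KontsevichZagierPeriods.KontsevichZagierPeriods.Theorems.HurwitzMicroSectorsNormalFormPrincipleSlabASubPtK20
import Summits.KontsevichZagierPeriods.KontsevichZagierPeriods.Theorems.HurwitzMicroSectorsNormalFormPrincipleAlgCarriers
import Summits.KontsevichZagierPeriods.KontsevichZagierPeriods.Theorems.HurwitzMicroSectorsNormalFormPrincipleM2FiveZetaTwo

/-!
# `NormalFormPrinciple` (stmt-KontsevichZagierPeriods-3869), line `SketchIdeator1` — leaf `stub_boxRigidity`: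
# level one with real-algebraic coefficients: monomials to algebraic points (rule 3)

Registered sub-goal `alg_monomials_to_points` of the layer "Conjecture 1 for
`[(0,1)², P(x,y)/(1 − xy)]`, `P ∈ (ℚ̄ ∩ ℝ)[x,y]`" (lead file `…AlgLevelOne`): for a real ALGEBRAIC
coefficient `c`,

1. the dimension-one polynomial box `N₁ = [(0,1), (c/k) s^b Σ_{i<k} s^i]` and the algebraic point
   `[pt, (c/k) Σ_{i<k} 1/(b+i+1)]` differ by a relation: ONE Newton–Leibniz move over the point with
   algebraic ends (`SlabAK20.slabA_sub_pt_mem_relations`), primitive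
   `F(s) = (c/k) Σ_{i<k} s^{b+i+1}/(b+i+1)`; the algebraic constant `c/k` times a `ℚ`-polynomial is a
   `ℚ`-semialgebraic function (`isSemialgebraicFunOn_const_of_isAlgebraic`, Tarski–Seidenberg);
2. the diagonal monomial box `M = [(0,1)², c (xy)^i]` and the algebraic point `[pt, c/(i+1)²]`
   differ by a relation: the open box is the band-box `{0 < x < 1, 0 ≤ y ≤ 1}` up to two null
   edges (rule 1a), ONE Newton–Leibniz move along `y ∈ [0,1]` over `(0,1)` with the primitive
   `(c/(i+1)) x^i y^{i+1}` lands on `[(0,1), (c/(i+1)) x^i]` (rule 3), and item 1 with `k = 1`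
   collapses it to the point `[pt, (c/(i+1))·1/(i+1)]`.

References: M. Kontsevich, D. Zagier, *Periods* (2001), §1.2 rules (1), (3). No new definitions.
-/

noncomputable section

open MeasureTheory Set
open Literature.NumberTheory.Transcendental Literature.NumberTheory.Transcendental.KZ
open Literature.ModelTheory.ExponentialFields (IsSemialgebraic)

namespace Summit.KontsevichZagierPeriods.HurwitzMicroSectors.NormalFormPrinciple.PiBox.AlgLevelOne

/-! ### Semialgebraic functions with one algebraic constant -/

/-- An algebraic constant times a `ℚ`-polynomial is a `ℚ`-semialgebraic function on every
`ℚ`-semialgebraic set (product of semialgebraic functions, Tarski–Seidenberg).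
[cite: BochnakCosteRoy1998, Prop. 2.2.6] -/
theorem isSemialgebraicFunOn_const_mul_aeval {n : ℕ} {s : Set (Fin n → ℝ)}
    (hs : IsSemialgebraic ℚ s) {c : ℝ} (hc : IsAlgebraic ℚ c) (p : MvPolynomial (Fin n) ℚ) :
    IsSemialgebraicFunOn ℚ s (fun x => c * (MvPolynomial.aeval x p : ℝ)) :=
  (IsSemialgebraicFunOn.mul_holds (isSemialgebraicFunOn_const_of_isAlgebraic hs hc)
    (isSemialgebraicFunOn_aeval hs p)).congr fun _ _ => rfl

/-- A rational multiple `c/k` of a real algebraic number is algebraic. [folklore] -/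
theorem isAlgebraic_div_nat {c : ℝ} (hc : IsAlgebraic ℚ c) (k : ℕ) :
    IsAlgebraic ℚ (c / (k : ℝ)) := by
  rw [div_eq_mul_inv]
  exact hc.mul (isAlgebraic_nat k).inv

/-! ### (1) The dimension-one polynomial box collapses to an algebraic point -/

/-- The primitive `F(s) = a Σ_{i<k} s^{b+i+1}/(b+i+1)` of `a s^b Σ_{i<k} s^i`. [folklore] -/
theorem polyBox_hasDerivAt (a : ℝ) (b k : ℕ) (t : ℝ) :
    HasDerivAt (fun s : ℝ => a * ∑ i ∈ Finset.range k, s ^ (b + i + 1) / ((b + i + 1 : ℕ) : ℝ))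
      (a * (t ^ b * ∑ i ∈ Finset.range k, t ^ i)) t := by
  have h : HasDerivAt (fun s : ℝ => ∑ i ∈ Finset.range k, s ^ (b + i + 1) / ((b + i + 1 : ℕ) : ℝ))
      (∑ i ∈ Finset.range k, t ^ (b + i)) t := by
    refine HasDerivAt.fun_sum fun i _ => ?_
    have hne : ((b + i + 1 : ℕ) : ℝ) ≠ 0 := by positivity
    refine ((hasDerivAt_pow (b + i + 1) t).div_const ((b + i + 1 : ℕ) : ℝ)).congr_deriv ?_
    rw [Nat.add_sub_cancel]
    field_simp
  refine (h.const_mul a).congr_deriv ?_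
  congr 1
  rw [Finset.mul_sum]
  exact Finset.sum_congr rfl fun i _ => pow_add t b i

/-- **(1) The dimension-one polynomial box collapses to an algebraic point.** For `c` real algebraic,
`[(0,1), (c/k) s^b Σ_{i<k} s^i] − [pt, (c/k) Σ_{i<k} 1/(b+i+1)] ∈ relations`: ONE Newton–Leibniz move
over the point with algebraic ends `0 ≤ 1` (`SlabAK20.slabA_sub_pt_mem_relations`) and the primitive
`F(s) = (c/k) Σ_{i<k} s^{b+i+1}/(b+i+1)`, an algebraic constant times a `ℚ`-polynomial.
[cite: KontsevichZagier2001, §1.2 rule (3)] -/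
theorem polyBox_sub_pt_mem_relations (c : ℝ) (hc : IsAlgebraic ℚ c) (b k : ℕ) (N₁ : IntegralRep 1)
    (Z : IntegralRep 0) (hN₁d : N₁.domain = {x | ∀ i, x i ∈ Set.Ioo (0:ℝ) 1})
    (hN₁i : EqOn N₁.integrand
      (fun x => c / (k : ℝ) * (x 0 ^ b * ∑ i ∈ Finset.range k, x 0 ^ i)) N₁.domain)
    (hZd : Z.domain = Set.univ)
    (hZi : Z.integrand = fun _ => c / (k : ℝ) * ∑ i ∈ Finset.range k, (1 : ℝ) / ((b + i + 1 : ℕ) : ℝ)) :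
    of N₁ - of Z ∈ relations := by
  have hK : IsSemialgebraic ℚ {x : Fin 1 → ℝ | x 0 ∈ Set.Icc (0:ℝ) 1} :=
    SlabAK20.isSemialgebraic_setOf_apply_mem_Icc_of_isAlgebraic isAlgebraic_zero isAlgebraic_one 0
  have hck : IsAlgebraic ℚ (c / (k : ℝ)) := isAlgebraic_div_nat hc k
  -- the integrand and the primitive are `(c/k)` times `ℚ`-polynomials
  have hf : IsSemialgebraicFunOn ℚ {x : Fin 1 → ℝ | x 0 ∈ Set.Icc (0:ℝ) 1}
      (fun x => (fun t : ℝ => c / (k : ℝ) * (t ^ b * ∑ i ∈ Finset.range k, t ^ i)) (x 0)) :=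
    (isSemialgebraicFunOn_const_mul_aeval hK hck
      (MvPolynomial.X 0 ^ b * ∑ i ∈ Finset.range k, MvPolynomial.X 0 ^ i)).congr fun x _ => by
      simp
  have hF : IsSemialgebraicFunOn ℚ {x : Fin 1 → ℝ | x 0 ∈ Set.Icc (0:ℝ) 1}
      (fun x => (fun t : ℝ => c / (k : ℝ) *
        ∑ i ∈ Finset.range k, t ^ (b + i + 1) / ((b + i + 1 : ℕ) : ℝ)) (x 0)) :=
    (isSemialgebraicFunOn_const_mul_aeval hK hck
      (∑ i ∈ Finset.range k, MvPolynomial.X 0 ^ (b + i + 1) *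
        MvPolynomial.C ((1 : ℚ) / ((b + i + 1 : ℕ) : ℚ)))).congr fun x _ => by
      simp [div_eq_mul_inv]
  have hFc : ContinuousOn (fun t : ℝ => c / (k : ℝ) *
      ∑ i ∈ Finset.range k, t ^ (b + i + 1) / ((b + i + 1 : ℕ) : ℝ)) (Set.Icc (0:ℝ) 1) :=
    (continuous_const.mul (continuous_finsetSum _ fun i _ =>
      (continuous_pow _).div_const _)).continuousOn
  have hNd : N₁.domain = {x | x 0 ∈ Set.Ioo (0:ℝ) 1} := by
    rw [hN₁d]
    exact Set.ext fun x => Fin.forall_fin_one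
  have hZi' : Z.integrand = fun _ =>
      (c / (k : ℝ) * ∑ i ∈ Finset.range k, (1:ℝ) ^ (b + i + 1) / ((b + i + 1 : ℕ) : ℝ)) -
      (c / (k : ℝ) * ∑ i ∈ Finset.range k, (0:ℝ) ^ (b + i + 1) / ((b + i + 1 : ℕ) : ℝ)) := by
    rw [hZi]
    funext
    simp
  exact SlabAK20.slabA_sub_pt_mem_relations isAlgebraic_zero isAlgebraic_one zero_le_one
    (fun t : ℝ => c / (k : ℝ) * (t ^ b * ∑ i ∈ Finset.range k, t ^ i))
    (fun t : ℝ => c / (k : ℝ) * ∑ i ∈ Finset.range k, t ^ (b + i + 1) / ((b + i + 1 : ℕ) : ℝ))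
    hF hFc (fun t _ => polyBox_hasDerivAt (c / (k : ℝ)) b k t) hf N₁ hNd hN₁i Z hZd hZi'

/-! ### (2) The diagonal monomial box collapses to an algebraic point -/

/-- **The band-box representation `[{0 < x < 1, 0 ≤ y ≤ 1}, c (xy)^i]` exists** (`c` real algebraic:
the integrand is an algebraic constant times a `ℚ`-polynomial, continuous on the compact cube).
[cite: KontsevichZagier2001, §1.1] -/
theorem exists_bandBoxRep_diag (c : ℝ) (hc : IsAlgebraic ℚ c) (i : ℕ) :
    ∃ Mb : IntegralRep 2,
      Mb.domain = KZlog.band {y : Fin 1 → ℝ | 0 < y 0 ∧ y 0 < 1} (fun _ => (0:ℝ)) (fun _ => (1:ℝ)) ∧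
      Mb.integrand = fun z => c * (z 0 * z 1) ^ i := by
  have hB := M2.isSemialgebraic_bandBox
  have hsa : IsSemialgebraicFunOn ℚ
      (KZlog.band {y : Fin 1 → ℝ | 0 < y 0 ∧ y 0 < 1} (fun _ => (0:ℝ)) (fun _ => (1:ℝ)))
      (fun z => c * (z 0 * z 1) ^ i) :=
    (isSemialgebraicFunOn_const_mul_aeval hB hc
      ((MvPolynomial.X 0 * MvPolynomial.X 1) ^ i)).congr fun z _ => by simp
  have hint : IntegrableOn (fun z : Fin 2 → ℝ => c * (z 0 * z 1) ^ i)
      (KZlog.band {y : Fin 1 → ℝ | 0 < y 0 ∧ y 0 < 1} (fun _ => (0:ℝ)) (fun _ => (1:ℝ))) :=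
    ((by fun_prop : Continuous fun z : Fin 2 → ℝ => c * (z 0 * z 1) ^ i).continuousOn
      |>.integrableOn_compact isCompact_Icc).mono_set M2.bandBox_subset_Icc
  exact ⟨⟨_, _, hB, hsa, hint⟩, rfl, rfl⟩

/-- **The dimension-one representation `[(0,1), (c/(i+1)) x^i]` exists** (`c` real algebraic).
[cite: KontsevichZagier2001, §1.1] -/
theorem exists_dimOneRep_diag (c : ℝ) (hc : IsAlgebraic ℚ c) (i : ℕ) :
    ∃ N₁ : IntegralRep 1, N₁.domain = {y : Fin 1 → ℝ | 0 < y 0 ∧ y 0 < 1} ∧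
      N₁.integrand = fun x => c / ((i + 1 : ℕ) : ℝ) * x 0 ^ i := by
  have hσ := isSemialgebraic_unitInterval_fin_one
  have hsa : IsSemialgebraicFunOn ℚ {y : Fin 1 → ℝ | 0 < y 0 ∧ y 0 < 1}
      (fun x => c / ((i + 1 : ℕ) : ℝ) * x 0 ^ i) :=
    (isSemialgebraicFunOn_const_mul_aeval hσ (isAlgebraic_div_nat hc (i + 1))
      (MvPolynomial.X 0 ^ i)).congr fun x _ => by simp
  have hsub : {y : Fin 1 → ℝ | 0 < y 0 ∧ y 0 < 1} ⊆ Set.Icc (0 : Fin 1 → ℝ) 1 := fun y hy =>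
    ⟨fun j => by fin_cases j; simpa using hy.1.le, fun j => by fin_cases j; simpa using hy.2.le⟩
  have hint : IntegrableOn (fun x : Fin 1 → ℝ => c / ((i + 1 : ℕ) : ℝ) * x 0 ^ i)
      {y : Fin 1 → ℝ | 0 < y 0 ∧ y 0 < 1} :=
    ((by fun_prop : Continuous fun x : Fin 1 → ℝ => c / ((i + 1 : ℕ) : ℝ) * x 0 ^ i).continuousOn
      |>.integrableOn_compact isCompact_Icc).mono_set hsub
  exact ⟨⟨_, _, hσ, hsa, hint⟩, rfl, rfl⟩

/-- **Newton–Leibniz along `y` on the band-box** (rule 3 over the base `(0,1)`): for `c` real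
algebraic, `[band-box, c (xy)^i] − [(0,1), (c/(i+1)) x^i] ∈ relations`, ONE generator with the
primitive `F(x,y) = (c/(i+1)) x^i y^{i+1}`, `∂F/∂y = c x^i y^i`, `F(x,1) − F(x,0) = (c/(i+1)) x^i`.
[cite: KontsevichZagier2001, §1.2 rule (3)] -/
theorem bandBox_diag_sub_dimOne_mem_relations (c : ℝ) (hc : IsAlgebraic ℚ c) (i : ℕ)
    (Mb : IntegralRep 2) (N₁ : IntegralRep 1)
    (hMbd : Mb.domain =
      KZlog.band {y : Fin 1 → ℝ | 0 < y 0 ∧ y 0 < 1} (fun _ => (0:ℝ)) (fun _ => (1:ℝ)))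
    (hMbi : Mb.integrand = fun z => c * (z 0 * z 1) ^ i)
    (hN₁d : N₁.domain = {y : Fin 1 → ℝ | 0 < y 0 ∧ y 0 < 1})
    (hN₁i : N₁.integrand = fun x => c / ((i + 1 : ℕ) : ℝ) * x 0 ^ i) :
    of Mb - of N₁ ∈ relations := by
  have hσ : IsSemialgebraic ℚ {y : Fin 1 → ℝ | 0 < y 0 ∧ y 0 < 1} :=
    isSemialgebraic_unitInterval_fin_one
  have hB := M2.isSemialgebraic_bandBox
  have hne : ((i + 1 : ℕ) : ℝ) ≠ 0 := by positivity
  have hs0 : ∀ (x : Fin 1 → ℝ) (t : ℝ), (Fin.snoc x t : Fin 2 → ℝ) 0 = x 0 := fun _ _ => rfl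
  have hs1 : ∀ (x : Fin 1 → ℝ) (t : ℝ), (Fin.snoc x t : Fin 2 → ℝ) 1 = t := fun _ _ => rfl
  refine newtonLeibnizRel_subset_relations ⟨1, Mb, N₁, fun _ => (0:ℝ), fun _ => (1:ℝ),
    fun z => c / ((i + 1 : ℕ) : ℝ) * (z 0 ^ i * z 1 ^ (i + 1)), ?_, ?_, ?_,
    fun _ _ => zero_le_one, ?_, ?_, ?_, ?_, rfl⟩
  · -- the primitive is an algebraic constant times a `ℚ`-polynomial on the band-box
    rw [hMbd]
    exact (isSemialgebraicFunOn_const_mul_aeval hB (isAlgebraic_div_nat hc (i + 1))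
      (MvPolynomial.X 0 ^ i * MvPolynomial.X 1 ^ (i + 1))).congr fun z _ => by simp
  · rw [hN₁d]
    simpa using isSemialgebraicFunOn_ratCast hσ 0
  · rw [hN₁d]
    simpa using isSemialgebraicFunOn_ratCast hσ 1
  · -- the band-box over `(0,1)` with edges `0 ≤ y ≤ 1`
    rw [hMbd, hN₁d]
    rfl
  · -- continuity of the primitive on the closed fibre
    intro x _
    simp only [hs0, hs1]
    exact (by fun_prop : Continuous fun t : ℝ =>
      c / ((i + 1 : ℕ) : ℝ) * (x 0 ^ i * t ^ (i + 1))).continuousOn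
  · -- its derivative on the open fibre is the integrand `c (x t)^i`
    intro x _ t _
    rw [hMbi]
    simp only [hs0, hs1]
    refine (((hasDerivAt_pow (i + 1) t).const_mul (x 0 ^ i)).const_mul
      (c / ((i + 1 : ℕ) : ℝ))).congr_deriv ?_
    rw [Nat.add_sub_cancel, mul_pow]
    field_simp
  · -- the endpoint difference
    intro x _
    rw [hN₁i]
    simp [hs0, hs1]

/-- **(2) The diagonal monomial box collapses to an algebraic point.** For `c` real algebraic,
`[(0,1)², c (xy)^i] − [pt, c/(i+1)²] ∈ relations`: two null edges (rule 1a) to the band-box, ONE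
Newton–Leibniz move along `y` (`bandBox_diag_sub_dimOne_mem_relations`), then (1) with `k = 1`.
[cite: KontsevichZagier2001, §1.2 rules (1), (3)] -/
theorem diagBox_sub_pt_mem_relations (c : ℝ) (hc : IsAlgebraic ℚ c) (i : ℕ) (M : IntegralRep 2)
    (Z : IntegralRep 0) (hMd : M.domain = {x | ∀ i, x i ∈ Set.Ioo (0:ℝ) 1})
    (hMi : EqOn M.integrand (fun x => c * (x 0 * x 1) ^ i) M.domain)
    (hZd : Z.domain = Set.univ) (hZi : Z.integrand = fun _ => c / (((i + 1) ^ 2 : ℕ) : ℝ)) :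
    of M - of Z ∈ relations := by
  obtain ⟨Mb, hMbd, hMbi⟩ := exists_bandBoxRep_diag c hc i
  obtain ⟨N₁, hN₁d, hN₁i⟩ := exists_dimOneRep_diag c hc i
  -- (a) rule 1a: the open box versus the band-box (two null edges)
  have h1 : of M - 1 • of Mb ∈ relations :=
    M2.of_box_sub_nsmul_of_band_mem_relations 1 (fun z => c * (z 0 * z 1) ^ i) M Mb hMd
      (fun x hx => by rw [hMi hx]; simp only [Nat.cast_one, one_mul]) hMbd
      (by rw [hMbi]; exact fun _ _ => rfl)
  rw [one_nsmul] at h1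
  -- (b) rule 3 along `y`
  have h2 := bandBox_diag_sub_dimOne_mem_relations c hc i Mb N₁ hMbd hMbi hN₁d hN₁i
  -- (c) item (1) with `k = 1` and the algebraic coefficient `c/(i+1)`
  have h3 : of N₁ - of Z ∈ relations := by
    refine polyBox_sub_pt_mem_relations (c / ((i + 1 : ℕ) : ℝ)) (isAlgebraic_div_nat hc (i + 1))
      i 1 N₁ Z ?_ (fun x _ => ?_) hZd ?_
    · rw [hN₁d]
      exact Eq.symm (Set.ext fun x => Fin.forall_fin_one)
    · rw [hN₁i]
      simp
    · rw [hZi]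
      funext
      simp only [Finset.sum_range_one, add_zero, Nat.cast_one, div_one, Nat.cast_pow]
      ring
  have e : of M - of Z = (of M - of Mb) + (of Mb - of N₁) + (of N₁ - of Z) := by abel
  rw [e]
  exact relations.add_mem (relations.add_mem h1 h2) h3

/-! ### The stub -/

/-- **Stub A3 (monomials to algebraic points, rule 3): the dimension-one polynomial box and the
diagonal monomial box collapse to points.** For `c` real algebraic: (1) `[(0,1), (c/k) s^b Σ_{i<k} s^i]
− [pt, (c/k) Σ_{i<k} 1/(b+i+1)] ∈ relations` by ONE Newton–Leibniz move over the point with algebraic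
ends (`SlabAK20.slabA_sub_pt_mem_relations`); (2) `[(0,1)², c (xy)^i] − [pt, c/(i+1)²] ∈ relations` by
one Newton–Leibniz move along `y` to dimension one and then (1).
[cite: KontsevichZagier2001, §1.2 rule (3)] -/
theorem alg_monomials_to_points (c : ℝ) (hc : IsAlgebraic ℚ c) :
    (∀ (b k : ℕ), 0 < k → ∀ (N₁ : IntegralRep 1) (Z : IntegralRep 0),
      N₁.domain = {x | ∀ i, x i ∈ Set.Ioo (0:ℝ) 1} →
      EqOn N₁.integrand (fun x => c / (k : ℝ) * (x 0 ^ b * ∑ i ∈ Finset.range k, x 0 ^ i)) N₁.domain →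
      Z.domain = Set.univ →
      (Z.integrand = fun _ => c / (k : ℝ) * ∑ i ∈ Finset.range k, (1 : ℝ) / ((b + i + 1 : ℕ) : ℝ)) →
      of N₁ - of Z ∈ relations) ∧
    (∀ (i : ℕ) (M : IntegralRep 2) (Z : IntegralRep 0),
      M.domain = {x | ∀ i, x i ∈ Set.Ioo (0:ℝ) 1} →
      EqOn M.integrand (fun x => c * (x 0 * x 1) ^ i) M.domain →
      Z.domain = Set.univ → (Z.integrand = fun _ => c / (((i + 1) ^ 2 : ℕ) : ℝ)) →
      of M - of Z ∈ relations) :=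
  ⟨fun b k _ N₁ Z hN₁d hN₁i hZd hZi => polyBox_sub_pt_mem_relations c hc b k N₁ Z hN₁d hN₁i hZd hZi,
    fun i M Z hMd hMi hZd hZi => diagBox_sub_pt_mem_relations c hc i M Z hMd hMi hZd hZi⟩

end Summit.KontsevichZagierPeriods.HurwitzMicroSectors.NormalFormPrinciple.PiBox.AlgLevelOne
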